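import Summits.AtomisticToContinuum.BoseEinsteinCondensation.Theorems.StaticResponseBound.Negative.Basic
import Literature.MathematicalPhysics.QuantumManyBody.BoseGasStructureFactor
import Literature.MathematicalPhysics.QuantumManyBody.PeriodicBoseGasMomentumSector
import HarnessLib

/-!
# drefute g4 — convention pins for line `stable-fraction-square-completion` (crux `StaticResponseBound`)

Kernel-checked read-back of the sign / normalisation conventions on which the TRUTH of the
classical stubs C2α (`stub_sectorDecomposition`, clauses (6) energy and (7) pairing) and C3
(`stub_windowAssembly`, `cosMean` versus `densityWave`) depends.  A mismatch in any of them would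
have made C2α FALSE as registered (the pairing `∑_q ⟨Φc(q+k), ρ̂_k Φc q⟩` would sum to `0`, not to
`⟨ρ̂_k⟩_Ψ`); all of them hold:

* `periodicEnergy_eq_lintegral` — `periodicEnergy` IS the integrand of C2α (6) (`rfl`);
* `densityWave_eq_sum_cellWave` — `ρ̂_k = ∑ⱼ e^{+2πik·xⱼ/L}` (PLUS sign);
* `smul_toLp_eq_latticeVec` — the momentum vector `(2π/L)•q` of C2α/B is `latticeVec (2π/L) q`;
* `hasTotalMomentum_densityWave` / `hasTotalMomentum_densityWave_mul` — `ρ̂_k` carries total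
  momentum `+2πk/L` in the tree's convention `ψ(X+s) = e^{+ik·s}ψ(X)`, hence maps the sector `q` to
  the sector `q + k`: the registered pairing against `Φc (q + k)` is the non-orthogonal one;
* `cosMean_eq_re_integral` — `⟨∑ⱼcos(p·xⱼ)⟩_Ψ = Re ∫ ρ̂_k |Ψ|²`, the bridge from C2α (7) to C2β/C3.
-/

namespace Summit.AtomisticToContinuum.BoseEinsteinCondensation.Cruxes.StaticResponseBound.DrefuteG4

open MeasureTheory WithLp
open scoped ENNReal ComplexConjugate
open Literature.MathematicalPhysics.QuantumManyBody.BoseGas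
open Summit.AtomisticToContinuum.BoseEinsteinCondensation.Theorems.StaticResponseBound.Negative
  (psq cosMean)

noncomputable section

variable {N : ℕ}

/-- Pin 1: the energy integrand of C2α clause (6) is `periodicEnergy`'s, definitionally. [folklore] -/
theorem periodicEnergy_eq_lintegral (v : ℝ → ℝ≥0∞) {L : ℝ} (Ψ : PeriodicTrialState N L) :
    periodicEnergy v Ψ =
      ∫⁻ X in cellN N L, (kineticDensity Ψ.ψ X + periodicInteraction v L X * (‖Ψ.ψ X‖₊ : ℝ≥0∞) ^ 2) :=
  rfl

/-- Pin 2: `ρ̂_k(X) = ∑ⱼ cellWave L k (xⱼ)` (plus sign in the exponent). [folklore] -/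
theorem densityWave_eq_sum_cellWave (L : ℝ) (k : Fin 3 → ℤ) (X : Config N) :
    densityWave N L k X = ∑ j, cellWave L k (X j) := by
  unfold densityWave
  refine Finset.sum_congr rfl fun j _ => ?_
  rw [cellWave_apply]
  congr 1
  push_cast
  ring

/-- Pin 3: the momentum vector written in C2α / B / C2β is the lattice vector `latticeVec (2π/L) q`.
[folklore] -/
theorem smul_toLp_eq_latticeVec (L : ℝ) (q : Fin 3 → ℤ) :
    ((2 * Real.pi / L) • (toLp 2 fun t => (q t : ℝ)) : EuclideanSpace ℝ (Fin 3)) =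
      latticeVec (2 * Real.pi / L) q := by
  ext t
  simp [latticeVec]

/-- Pin 4: `ρ̂_k` has total momentum `+2πk/L`. [folklore] -/
theorem hasTotalMomentum_densityWave (L : ℝ) (k : Fin 3 → ℤ) :
    HasTotalMomentum (latticeVec (2 * Real.pi / L) k) (densityWave N L k) := by
  have h := HasTotalMomentum.sum (M := N) Finset.univ
    (ψ := fun j X => cellWave L k (X j)) (fun j _ => hasTotalMomentum_cellWave L k j)
  have hfun : (fun X : Config N => ∑ j ∈ Finset.univ, cellWave L k (X j)) = densityWave N L k := by
    funext X; rw [densityWave_eq_sum_cellWave]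
  rwa [hfun] at h

/-- Pin 5: `ρ̂_k` maps the sector `2πq/L` to the sector `2π(q+k)/L` — so in C2α (7) the pairing of
`ρ̂_k Φc q` against `Φc (q + k)` is the NON-orthogonal one (against `Φc (q − k)` it would vanish).
[folklore] -/
theorem hasTotalMomentum_densityWave_mul {L : ℝ} {k q : Fin 3 → ℤ} {Φ : Config N → ℂ}
    (hΦ : HasTotalMomentum
      ((2 * Real.pi / L) • (toLp 2 fun t => (q t : ℝ)) : EuclideanSpace ℝ (Fin 3)) Φ) :
    HasTotalMomentum
      ((2 * Real.pi / L) • (toLp 2 fun t => ((q + k) t : ℝ)) : EuclideanSpace ℝ (Fin 3))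
      (fun X => densityWave N L k X * Φ X) := by
  have h := (hasTotalMomentum_densityWave (N := N) L k).mul hΦ
  have hvec : latticeVec (2 * Real.pi / L) k +
      ((2 * Real.pi / L) • (toLp 2 fun t => (q t : ℝ)) : EuclideanSpace ℝ (Fin 3)) =
      ((2 * Real.pi / L) • (toLp 2 fun t => ((q + k) t : ℝ)) : EuclideanSpace ℝ (Fin 3)) := by
    ext t
    simp [latticeVec]
    ring
  rwa [hvec] at h

/-- Pin 6: `⟨∑ⱼ cos(p·xⱼ)⟩_Ψ = Re ∫_{cell^N} ρ̂_k |Ψ|²` — the bridge from the complex pairing sum of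
C2α (7) to the real `cosMean` of C2β / C3 / the crux. [folklore] -/
theorem cosMean_eq_re_integral {L : ℝ} (k : Fin 3 → ℤ) (Ψ : PeriodicTrialState N L) :
    cosMean L k Ψ =
      (∫ X in cellN N L, densityWave N L k X * (((‖Ψ.ψ X‖ ^ 2 : ℝ)) : ℂ)).re := by
  have hcont : Continuous fun X : Config N => densityWave N L k X * (((‖Ψ.ψ X‖ ^ 2 : ℝ)) : ℂ) :=
    (continuous_densityWave L k).mul
      (Complex.continuous_ofReal.comp ((Ψ.contDiff.continuous.norm).pow 2))
  have hint : Integrable (fun X : Config N => densityWave N L k X * (((‖Ψ.ψ X‖ ^ 2 : ℝ)) : ℂ))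
      (volume.restrict (cellN N L)) := integrableOn_cellN hcont L
  have hre := integral_re hint
  simp only [RCLike.re_to_complex] at hre
  rw [← hre]
  unfold cosMean
  refine integral_congr_ae (Filter.Eventually.of_forall fun X => ?_)
  simp only [Complex.mul_re, Complex.ofReal_re, Complex.ofReal_im, mul_zero, sub_zero]
  congr 1
  unfold densityWave
  rw [Complex.re_sum]
  refine Finset.sum_congr rfl fun j _ => ?_
  simp [Complex.exp_re, Complex.mul_re, Complex.mul_im, Complex.I_re, Complex.I_im]

end

end Summit.AtomisticToContinuum.BoseEinsteinCondensation.Cruxes.StaticResponseBound.DrefuteG4
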